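import Summits.QuantumFields.YangMills.Theorems.UnitScaleTiltProp7ActionGradCurrentT3
import Summits.QuantumFields.YangMills.Theorems.UnitScaleTiltProp7SectET3DeltaOneT3PInvGlue
import Summits.QuantumFields.YangMills.Theorems.UnitScaleTiltProp7SectET3CurvedPropagatorsT3
import Summits.QuantumFields.YangMills.Theorems.UnitScaleTiltProp8ChartHInvComb
import Summits.QuantumFields.YangMills.Theorems.UnitScaleTiltProp7LandauDictT3
import Summits.QuantumFields.YangMills.Theorems.UnitScaleTiltProp7SectET3RealCoordSums
import Literature.MathematicalPhysics.QuantumFieldTheory.Balaban1983to89.MatrixNorms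
import HarnessLib

/-!
# Route `UnitScaleTilt`, crux K1 «MinimiserStabilityRegPr» (stmt-QuantumFields-19200) — ★★OWNER RULING g28-№13 (c3) «A6 BY KERNEL AT THE FLAT MEMBER», FILE A:
# **THE LETTERS OF `Δ_a(U₀) = Δx(U₀) + D R_S D* + Q*aQ` (brick L0d `laplaceA`) AT THE TRIVIAL BACKGROUND `U₀ = 1`, IN THE VOCABULARY OF ✓`Prop7FlatCoercivityR.flat_coercive_R_T3`**

Cell `ym3-torus`, width seat `ym3-torus-px6` g5 (LOCATE «(c3) A6-FLAT GUARD» `LOCATE-A6FLAT-px6g5.md` sha16 75393a2303e20e25 = 19200 evidence #58; ★★OWNER ACK 91 «(c2)∕(c3) OF RECORD … px6 g5 owns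
the (c3) certificate»; ★p1 g17 WORD 10 (2) «px6 g5: A6-FLAT GO — FILE A now»).  THEOREMS ONLY (0 `def`, 0 `sorry`); `--supports stmt-QuantumFields-19200 --as helper`; count-neutral.
YM₃ on T³ is ladder rung R3, NOT d = 4, NOT the Clay problem; nothing here claims the stub, the crux, HESS, `hcoW` or the mass gap.

WHY.  RULING g28-№13 accepts ONE displayed analytic input for the (A′) architecture — a coercivity row «`γ(L)·‖y‖² ≤ re⟪y, Δ_a(W) y⟫`» for brick L0d's
`laplaceA F n K h c₀ cB a Δx W` — on condition (c3): its instance at `U₀ = 1` must follow BY NAME from ✓`flat_coercive_R_T3` (`γ(3,a)·Σ_b x_b² ≤ Σ_p (curl (L^{K−n}) x p)² +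
‖RE … (dsE … x)‖² + a·(L^{K−n})³·Σ_c (Q_{K−n}x)(c)²`, REAL scalar bond fields).  The member's letters live on lit-balaban's weighted `L²` spaces (`BondL2K ℂ 3 (periodsT3 F K) c₀ W₂`,
Hilbert fibre `W₂ ≃ M₂(ℂ)`), so the certificate needs the flat values of the four letters in `LatticeFieldCalculus` currency.  This file supplies them (the LOCATE's seams S1, S2, S3, S5):
* §1 `‖toL2 X‖² = c₀·Σ_b Σ_{jj′}|X(b)_{jj′}|²` and its split into the 8 real components;
* §2 **`re⟪toL2 X, Δ^η(1)(toL2 X)⟫ = c₀·η⁻²·Σ_p Σ_{jj′}|(curl₁X)(p)_{jj′}|²`** — brick L0b's `DeltaEta` through ★px5 ✓`DeltaEta_toL2_eq` (= lit's (3.10) operator), `Δ′ = 0` at `U ≡ 1`, (3.9) by parts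
  (lit ✓`sum_posPlaq_curl_mul`), and the dictionary [B9]-curl-at-`1` = `LatticeFieldCalculus.curl 1`;
* §3 `actionGrad 1 = 0` (the current `J` of (3.11) vanishes at `U ≡ 1`), hence `TJSlotP 1 = 0` and the `hPosΔ` slot `DeltaEtaSlot + TJSlotP` at `1` IS `DeltaEta 1`;
* §4 `toL2S⁻¹(D*(1)(toL2 X)) = η⁻¹ • diverg 1 X` ((3.8) at `U ≡ 1` = [B5] (1.21)) and the site norm `‖toL2S λ‖² = c₀·Σ_x Σ|λ(x)_{jj′}|²`;
* §5 **`Q_k(1)(toL2 X) = toL2B (bondAvgIter (K−n) X ∘ bondShift)`** and `‖Q_k(1)(toL2 X)‖² = cB·Σ_{c′ : PBond (F.P K)(K−n)} Σ|(Q_{K−n}X)(c′)_{jj′}|²` — print's A-units `Qk = η•QL2` with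
  `QTwS 1 = L^{K−n}•bondAvgIter` (✓`QTwS_one_apply`): **NO power of `η` survives**, which is the LOCATE's (V1)∕(V2): against the flat theorem's `a·(L^{K−n})³` the `Q*aQ` weight must be
  member-scaled `a := a₀·(c₀∕cB)·(L^(K−n))^3` (namer rule, ★p1 g17 WORD 10; OWNER ACK 91).
FILE B (the projector seam S4 «`range RE ≤ range R_S(1)` entrywise» + the knit ⟹ `coercive_laplaceA_one`) follows after the EX namer's (c1) letter.

HONEST SCOPE.  Bookkeeping over landed letters at the trivial background; no estimate, no positivity, nothing at `U₀ ≠ 1`; nothing of [B9] §3 asserted.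

References: T. Bałaban, CMP **99** (1985) 389–434 [Balaban1985BackgroundPropagators] ((3.8)–(3.12) p.392, (3.14) p.393, (3.21) p.394, (3.26) p.395, (3.127)–(3.128) p.421);
CMP **95** (1984) 17–40 [Balaban1984PropagatorsI] ((1.2) p.18, (1.18) p.20, (1.21) p.21, Prop. 1.1 (1.90) p.33); CMP **102** (1985) 277–309 [Balaban1985Variational] ((44)–(45) p.285,
(110) p.294, (141)–(142) p.299); CMP **98** (1985) 17–51 [Balaban1985Averaging] ((18) p.21).
-/

set_option autoImplicit false

noncomputable section

open scoped InnerProductSpace ComplexConjugate Matrix.Norms.L2Operator BigOperators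
open Complex (I)

namespace Summit.QuantumFields.YangMills.Theorems.Prop7LaplaceAFlatLetters

open Literature.MathematicalPhysics.QuantumFieldTheory.Balaban1983to89
open Literature.MathematicalPhysics.QuantumFieldTheory.Balaban1983to89.T3ContinuumYM3Torus
open T3SectALandauChart (formComp bgUnits bgUnits_one eta eta_pos)
open LatticeFieldCalculus (curl diverg grad bondAvgIter siteAvgIter)
open B9TorusCalculus (torusT)
open B9SectCLatticeCarrier (Bond)
open B9Eq311L2Pairing (WL2)
open B11Eq103H1Complex (SiteL2K BondL2K)
open Summit.QuantumFields.YangMills.Theorems.Prop7SectET3Transport (periodsT3 siteEquiv bondEquiv bgOfCfg)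
open Summit.QuantumFields.YangMills.Theorems.Prop7SectET3HilbertLetters (W₂ frobEquiv toL2 toL2S toL2B QL2 DL2 DstarL2 inner_toL2 inner_toL2B)
open Summit.QuantumFields.YangMills.Theorems.Prop7SectET3WilsonHessian (DeltaEta DeltaEtaSlot)
open Summit.QuantumFields.YangMills.Theorems.Prop7SectET3DeltaEtaExplicit (DeltaEta_toL2_eq sum_pbond_eq)
open Summit.QuantumFields.YangMills.Theorems.Prop7SectET3DeltaOne (actionGrad)
open Summit.QuantumFields.YangMills.Theorems.Prop7SectET3DeltaOnePInv (TJP TJSlotP TJP_eq_zero_of_actionGrad_eq_zero)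
open Summit.QuantumFields.YangMills.Theorems.Prop7SectET3CurvedPropagators (Qk laplaceA)
open Summit.QuantumFields.YangMills.Theorems.Prop7ActionGradCurrent (actionGrad_eq_neg_I_mul_bondPair_J)
open Summit.QuantumFields.YangMills.Theorems.Prop7LandauDict (bondEquiv_symm_unshift bondEquiv_symm_siteEquiv)
open Summit.QuantumFields.YangMills.Theorems.Prop7SectET3RealCoordSums (inner_toL2S)

variable {F : T3Family} {n K : ℕ} {c₀ : ℝ}

/-! ## §1 The member's `L²` norm entrywise -/

/-- Bookkeeping: a sum of squared entry moduli of a family of `2 × 2` matrices, split into real and imaginary parts and re-indexed by the entry. [folklore] -/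
theorem sum_entries_re_im {ι : Type*} [Fintype ι] (G : ι → Matrix (Fin 2) (Fin 2) ℂ) :
    ∑ t, ∑ i, ∑ i', ‖G t i i'‖ ^ 2 = ∑ i, ∑ i', (∑ t, (G t i i').re ^ 2 + ∑ t, (G t i i').im ^ 2) := by
  rw [Finset.sum_comm]
  refine Finset.sum_congr rfl fun i _ => ?_
  rw [Finset.sum_comm]
  refine Finset.sum_congr rfl fun i' _ => ?_
  rw [← Finset.sum_add_distrib]
  exact Finset.sum_congr rfl fun t _ => by rw [Complex.sq_norm, Complex.normSq_apply]; ring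

/-- **THE MEMBER'S WEIGHTED `L²` NORM, ENTRYWISE**: `‖toL2 X‖² = c₀ · Σ_b Σ_{jj′} |X(b)_{jj′}|²` (print's pairing (3.11) `⟨A, A⟩ = Σ_b η^d tr A(b)*A(b)` with the
Hilbert–Schmidt product of [Balaban1985Averaging] (18)). [cite: Balaban1985BackgroundPropagators, (3.11) p.392; Balaban1985Averaging, (18) p.21] -/
theorem norm_sq_toL2 [Fact (0 < c₀)] (X : PBond (F.P K) 0 → Matrix (Fin 2) (Fin 2) ℂ) :
    ‖toL2 F K c₀ X‖ ^ 2 = c₀ * ∑ b : PBond (F.P K) 0, ∑ i, ∑ i', ‖X b i i'‖ ^ 2 := by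
  rw [@norm_sq_eq_re_inner ℂ, inner_toL2, RCLike.re_to_complex, Complex.re_ofReal_mul, Complex.re_sum]
  congr 1
  exact Finset.sum_congr rfl fun b _ => (MatrixNorms.sum_norm_sq_eq_re_trace (X b)).symm

/-- The same split into the `8` REAL components `re X_{jj′}`, `im X_{jj′}`. [cite: Balaban1985BackgroundPropagators, (3.11) p.392] -/
theorem norm_sq_toL2_re_im [Fact (0 < c₀)] (X : PBond (F.P K) 0 → Matrix (Fin 2) (Fin 2) ℂ) :
    ‖toL2 F K c₀ X‖ ^ 2 = c₀ * ∑ i, ∑ i', (∑ b : PBond (F.P K) 0, (X b i i').re ^ 2 + ∑ b : PBond (F.P K) 0, (X b i i').im ^ 2) := by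
  rw [norm_sq_toL2, sum_entries_re_im]

/-! ## §2 The Wilson Hessian `Δ^η(1)` at the trivial background: `η⁻²·Σ_p |curl X(p)|²` -/

section FlatHessian

variable {P : Params} {j : ℕ}

/-- **AT `U ≡ 1` THE CURVATURE PART `Δ′` OF (3.10) VANISHES** (`Re U(∂p) − 1 = 0 = Im U(∂p)`): lit ✓`B9Eq310Hermitian`'s closing sanity example, as a theorem on the
route's torus. [cite: Balaban1985BackgroundPropagators, (3.10) p.392] -/
theorem deltaPrimeOp_one (η : ℝ) (A : Fin P.d → Site P j → Matrix (Fin 2) (Fin 2) ℂ) (μ : Fin P.d) (x : Site P j) :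
    B9Eq310Hermitian.deltaPrimeOp (torusT P j) (fun (_ : Fin P.d) (_ : Site P j) => (1 : (Matrix (Fin 2) (Fin 2) ℂ)ˣ)) η A μ x = 0 := by
  simp [B9Eq310Hermitian.deltaPrimeOp, B9Eq39Adjoint.divP, B9Eq310Hermitian.divL, B9Eq39Adjoint.covDstar, B9Eq310Hermitian.jordanF,
    B9Eq310Hermitian.commG₁, B9Eq310Hermitian.commG₂, B9Eq310Hermitian.commG₃, B9Eq310Hermitian.commG₄, B9Eq310Hermitian.zP, B9Eq310Hermitian.yP,
    B9Eq39Adjoint.plaqU, B9Eq39Adjoint.R]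

/-- **AT `U ≡ 1` lit's (3.10) operator `deltaOp` IS `D¹*D¹ = divP ∘ curl`** at unit spacing. [cite: Balaban1985BackgroundPropagators, (3.10) p.392] -/
theorem deltaOp_one (A : Fin P.d → Site P j → Matrix (Fin 2) (Fin 2) ℂ) (μ : Fin P.d) (x : Site P j) :
    B9Eq310Hermitian.deltaOp (torusT P j) (fun (_ : Fin P.d) (_ : Site P j) => (1 : (Matrix (Fin 2) (Fin 2) ℂ)ˣ)) 1 A μ x
      = B9Eq39Adjoint.divP (torusT P j) (fun (_ : Fin P.d) (_ : Site P j) => (1 : (Matrix (Fin 2) (Fin 2) ℂ)ˣ))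
          (B9Eq39Adjoint.curl (torusT P j) (fun (_ : Fin P.d) (_ : Site P j) => (1 : (Matrix (Fin 2) (Fin 2) ℂ)ˣ)) A) μ x := by
  have hcurl : B9Eq39Adjoint.curlη (torusT P j) (fun (_ : Fin P.d) (_ : Site P j) => (1 : (Matrix (Fin 2) (Fin 2) ℂ)ˣ)) 1 A
      = B9Eq39Adjoint.curl (torusT P j) (fun (_ : Fin P.d) (_ : Site P j) => (1 : (Matrix (Fin 2) (Fin 2) ℂ)ˣ)) A := by
    funext μ ν x
    rw [B9Eq39Adjoint.curlη, Complex.ofReal_one, inv_one, one_smul]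
  rw [B9Eq310Hermitian.deltaOp, deltaPrimeOp_one, add_zero, B9Eq39Adjoint.divPη, hcurl, Complex.ofReal_one, inv_one, one_smul]

/-- **DICTIONARY**: at `U ≡ 1`, [B9]'s plaquette variable `(D¹A)(p_{μν}(x))` of the site-indexed components `formComp X` IS `LatticeFieldCalculus.curl 1 X` at the route's plaquette
`⟨x, μ, ν⟩` (`B9TorusCalculus.covD_one_eq_pdiff` twice + `LatticeFieldCalculus.curl_eq_pdiff`). [cite: Balaban1985BackgroundPropagators, (3.4) p.391; Balaban1984PropagatorsI, (1.2) p.18] -/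
theorem curl_torusT_one_formComp (X : PBond P j → Matrix (Fin 2) (Fin 2) ℂ) {μ ν : Fin P.d} (hμν : μ < ν) (x : Site P j) :
    B9Eq39Adjoint.curl (torusT P j) (fun (_ : Fin P.d) (_ : Site P j) => (1 : (Matrix (Fin 2) (Fin 2) ℂ)ˣ)) (formComp X) μ ν x = curl 1 X ⟨x, μ, ν, hμν⟩ := by
  rw [B9Eq39Adjoint.curl, B9TorusCalculus.covD_one_eq_pdiff, B9TorusCalculus.covD_one_eq_pdiff, LatticeFieldCalculus.curl_eq_pdiff]
  rfl

/-- Plaquette sums: the route's `Plaq P j` versus [B9]'s `posPlaq` triples `(x, μ < ν)`. [folklore] -/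
theorem sum_plaq_eq_sum_posPlaq' {M : Type*} [AddCommMonoid M] (f : Site P j → Fin P.d → Fin P.d → M) :
    ∑ p : Plaq P j, f p.src p.μ p.ν = ∑ q ∈ B9Eq39Adjoint.posPlaq (Site P j) (Fin P.d), f q.1 q.2.1 q.2.2 := by
  classical
  refine Finset.sum_bij (fun p _ => (p.src, p.μ, p.ν)) (fun p _ => by simp [p.hμν]) (fun p _ q _ hpq => ?_) (fun q hq => ?_) (fun _ _ => rfl)
  · obtain ⟨x, μ, ν, h⟩ := p
    obtain ⟨x', μ', ν', h'⟩ := q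
    simp only [Prod.mk.injEq] at hpq
    obtain ⟨rfl, rfl, rfl⟩ := hpq
    rfl
  · exact ⟨⟨q.1, q.2.1, q.2.2, by simpa using hq⟩, Finset.mem_univ _, rfl⟩

/-- **THE `D*D` FORM BY PARTS, HILBERT–SCHMIDT VERSION**: at `U ≡ 1`, `Σ_x Σ_μ tr(A_μ(x)ᴴ · (D¹*D¹A)_μ(x)) = Σ_{p} tr((D¹A)(p)ᴴ (D¹A)(p))` — lit ✓`sum_posPlaq_curl_mul` ((3.9)) at the
test field `Aᴴ`, with `(D¹Aᴴ)(p) = ((D¹A)(p))ᴴ` (lit ✓`star_curl`, trivially unitary background). [cite: Balaban1985BackgroundPropagators, (3.9)–(3.10) p.392] -/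
theorem sum_trace_conjTranspose_mul_divP_curl_one [Fintype (Site P j)] (A : Fin P.d → Site P j → Matrix (Fin 2) (Fin 2) ℂ) :
    ∑ x : Site P j, ∑ μ : Fin P.d, Matrix.trace ((A μ x).conjTranspose *
        B9Eq39Adjoint.divP (torusT P j) (fun (_ : Fin P.d) (_ : Site P j) => (1 : (Matrix (Fin 2) (Fin 2) ℂ)ˣ))
          (B9Eq39Adjoint.curl (torusT P j) (fun (_ : Fin P.d) (_ : Site P j) => (1 : (Matrix (Fin 2) (Fin 2) ℂ)ˣ)) A) μ x)
      = ∑ q ∈ B9Eq39Adjoint.posPlaq (Site P j) (Fin P.d),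
          Matrix.trace ((B9Eq39Adjoint.curl (torusT P j) (fun (_ : Fin P.d) (_ : Site P j) => (1 : (Matrix (Fin 2) (Fin 2) ℂ)ˣ)) A q.2.1 q.2.2 q.1).conjTranspose *
            B9Eq39Adjoint.curl (torusT P j) (fun (_ : Fin P.d) (_ : Site P j) => (1 : (Matrix (Fin 2) (Fin 2) ℂ)ˣ)) A q.2.1 q.2.2 q.1) := by
  have hU : ∀ (μ : Fin P.d) (x : Site P j), ((((fun (_ : Fin P.d) (_ : Site P j) => (1 : (Matrix (Fin 2) (Fin 2) ℂ)ˣ)) μ x)⁻¹ : (Matrix (Fin 2) (Fin 2) ℂ)ˣ) :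
      Matrix (Fin 2) (Fin 2) ℂ) = star (((fun (_ : Fin P.d) (_ : Site P j) => (1 : (Matrix (Fin 2) (Fin 2) ℂ)ˣ)) μ x : (Matrix (Fin 2) (Fin 2) ℂ)ˣ) : Matrix (Fin 2) (Fin 2) ℂ) :=
    fun _ _ => by simp
  have h := B9Eq39Adjoint.sum_posPlaq_curl_mul (torusT P j) (fun (_ : Fin P.d) (_ : Site P j) => (1 : (Matrix (Fin 2) (Fin 2) ℂ)ˣ))
    (Matrix.traceLinearMap (Fin 2) ℂ ℂ) (fun a b => Matrix.trace_mul_comm a b) (star A)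
    (B9Eq39Adjoint.curl (torusT P j) (fun (_ : Fin P.d) (_ : Site P j) => (1 : (Matrix (Fin 2) (Fin 2) ℂ)ˣ)) A)
  simp only [Matrix.traceLinearMap_apply, ← B9Eq310Hermitian.star_curl _ _ hU, Matrix.star_eq_conjTranspose, Pi.star_apply] at h
  exact h.symm

end FlatHessian

/-- ★★ **THE WILSON HESSIAN OF RECORD AT THE TRIVIAL BACKGROUND IS `η⁻²·‖curl X‖²`**: `re⟨toL2 X, Δ^η(1)(toL2 X)⟩ = c₀·η⁻²·Σ_p Σ_{jj′} |(curl₁X)(p)_{jj′}|²` — brick L0b's `DeltaEta` read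
through ★px5's ✓`DeltaEta_toL2_eq` (= lit's (3.10) operator `η⁻²(D¹*D¹ + Δ′₁)`), `Δ′₁ = 0` at `U ≡ 1`, (3.9) by parts, and the dictionary with `LatticeFieldCalculus.curl 1` («the operator ∂*∂ in the
Abelian case», p. 392). [cite: Balaban1985BackgroundPropagators, (3.9)–(3.12) p.392; Balaban1984PropagatorsI, (1.2) p.18] -/
theorem re_inner_DeltaEta_one [Fact (0 < c₀)] (X : PBond (F.P K) 0 → Matrix (Fin 2) (Fin 2) ℂ) :
    RCLike.re ⟪toL2 F K c₀ X, DeltaEta F n K c₀ 1 (toL2 F K c₀ X)⟫_ℂ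
      = c₀ * (eta F n K)⁻¹ ^ 2 * ∑ p : Plaq (F.P K) 0, ∑ i, ∑ i', ‖curl 1 X p i i'‖ ^ 2 := by
  set T := torusT (F.P K) 0 with hT
  set U1 : Fin (F.P K).d → Site (F.P K) 0 → (Matrix (Fin 2) (Fin 2) ℂ)ˣ := fun _ _ => 1 with hU1
  have hbg : (fun (μ : Fin (F.P K).d) (x : Site (F.P K) 0) => bgUnits F K (1 : GaugeField (F.P K) 0 (Matrix.specialUnitaryGroup (Fin 2) ℂ)) ⟨x, μ⟩) = U1 := by
    funext μ x; rw [bgUnits_one]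
  rw [DeltaEta_toL2_eq, hbg, inner_toL2, RCLike.re_to_complex, ← hT]
  -- per bond: `tr(Xᴴ (c • E)) = c · tr(Xᴴ E)` and `Δ(1) = divP ∘ curl`
  have hper : ∀ b : PBond (F.P K) 0,
      Matrix.trace ((X b).conjTranspose * ((((eta F n K)⁻¹ ^ 2 : ℝ) : ℂ) • B9Eq310Hermitian.deltaOp T U1 1 (formComp X) b.dir b.src))
        = (((eta F n K)⁻¹ ^ 2 : ℝ) : ℂ) * Matrix.trace ((formComp X b.dir b.src).conjTranspose * B9Eq39Adjoint.divP T U1 (B9Eq39Adjoint.curl T U1 (formComp X)) b.dir b.src) := by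
    intro b
    rw [Matrix.mul_smul, Matrix.trace_smul, smul_eq_mul, hT, hU1, deltaOp_one]
    rfl
  simp only [hper, ← Finset.mul_sum]
  rw [sum_pbond_eq (fun b : PBond (F.P K) 0 => Matrix.trace ((formComp X b.dir b.src).conjTranspose * B9Eq39Adjoint.divP T U1 (B9Eq39Adjoint.curl T U1 (formComp X)) b.dir b.src))]
  rw [show (∑ x : Site (F.P K) 0, ∑ μ : Fin (F.P K).d, Matrix.trace ((formComp X μ x).conjTranspose * B9Eq39Adjoint.divP T U1 (B9Eq39Adjoint.curl T U1 (formComp X)) μ x))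
      = ∑ q ∈ B9Eq39Adjoint.posPlaq (Site (F.P K) 0) (Fin (F.P K).d),
          Matrix.trace ((B9Eq39Adjoint.curl T U1 (formComp X) q.2.1 q.2.2 q.1).conjTranspose * B9Eq39Adjoint.curl T U1 (formComp X) q.2.1 q.2.2 q.1) by
    rw [hT, hU1]; exact sum_trace_conjTranspose_mul_divP_curl_one (formComp X)]
  rw [← sum_plaq_eq_sum_posPlaq' (fun x μ ν => Matrix.trace ((B9Eq39Adjoint.curl T U1 (formComp X) μ ν x).conjTranspose * B9Eq39Adjoint.curl T U1 (formComp X) μ ν x))]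
  -- the Hilbert–Schmidt square is real and equals `Σ|·|²`; the [B9] curl is `LatticeFieldCalculus.curl 1`
  have hsq : ∀ p : Plaq (F.P K) 0, Matrix.trace ((B9Eq39Adjoint.curl T U1 (formComp X) p.μ p.ν p.src).conjTranspose * B9Eq39Adjoint.curl T U1 (formComp X) p.μ p.ν p.src)
      = ((∑ i, ∑ i', ‖curl 1 X p i i'‖ ^ 2 : ℝ) : ℂ) := by
    intro p
    rw [hT, hU1, curl_torusT_one_formComp X p.hμν p.src, MatrixNorms.sum_norm_sq_eq_re_trace]
    have hreal : star (Matrix.trace ((curl 1 X p).conjTranspose * curl 1 X p)) = Matrix.trace ((curl 1 X p).conjTranspose * curl 1 X p) := by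
      rw [← Matrix.trace_conjTranspose, Matrix.conjTranspose_mul, Matrix.conjTranspose_conjTranspose, Matrix.trace_mul_comm]
    exact (Complex.conj_eq_iff_re.1 hreal).symm
  simp only [hsq]
  rw [← Complex.ofReal_sum, ← Complex.ofReal_mul, ← Complex.ofReal_mul, Complex.ofReal_re, mul_assoc]

/-- The same split into the `8` REAL components: `re⟨toL2 X, Δ^η(1)(toL2 X)⟩ = c₀·η⁻²·Σ_{jj′} (Σ_p (curl₁ re X_{jj′})(p)² + Σ_p (curl₁ im X_{jj′})(p)²)` (the curl acts entrywise and
commutes with `re`∕`im`). [cite: Balaban1985BackgroundPropagators, (3.10) p.392; Balaban1985Variational, p.288] -/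
theorem re_inner_DeltaEta_one_re_im [Fact (0 < c₀)] (X : PBond (F.P K) 0 → Matrix (Fin 2) (Fin 2) ℂ) :
    RCLike.re ⟪toL2 F K c₀ X, DeltaEta F n K c₀ 1 (toL2 F K c₀ X)⟫_ℂ
      = c₀ * (eta F n K)⁻¹ ^ 2 * ∑ i, ∑ i', (∑ p : Plaq (F.P K) 0, curl 1 (fun b => (X b i i').re) p ^ 2 + ∑ p : Plaq (F.P K) 0, curl 1 (fun b => (X b i i').im) p ^ 2) := by
  refine (re_inner_DeltaEta_one X).trans ?_
  rw [sum_entries_re_im]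
  refine congrArg (fun t : ℝ => c₀ * (eta F n K)⁻¹ ^ 2 * t) (Finset.sum_congr rfl fun i _ => Finset.sum_congr rfl fun i' _ => ?_)
  -- an `ℝ`-linear functional of the coefficients commutes with the curl (cf. `K0Stub1FlatHessianLandauCoercivity.map_curl`, other route)
  have hmap : ∀ (φ : Matrix (Fin 2) (Fin 2) ℂ →ₗ[ℝ] ℝ) (p : Plaq (F.P K) 0), φ (curl 1 X p) = curl 1 (fun b => φ (X b)) p := fun φ p => by
    simp only [LatticeFieldCalculus.curl, map_smul, map_add, map_sub]
  have hre : ∀ p : Plaq (F.P K) 0, (curl 1 X p i i').re = curl 1 (fun b => (X b i i').re) p := fun p =>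
    hmap (Complex.reLm ∘ₗ Matrix.entryLinearMap ℝ ℂ i i') p
  have him : ∀ p : Plaq (F.P K) 0, (curl 1 X p i i').im = curl 1 (fun b => (X b i i').im) p := fun p =>
    hmap (Complex.imLm ∘ₗ Matrix.entryLinearMap ℝ ℂ i i') p
  simp only [hre, him]

/-! ## §3 The J-term vanishes at the trivial background -/

/-- **THE FLAT BACKGROUND IS CRITICAL: `actionGrad 1 = 0`** — the current `J = D*η⁻²Im ∂U` of (3.11) vanishes at `U ≡ 1` (`Im 1 = 0`).
[cite: Balaban1985BackgroundPropagators, (3.11)–(3.12) p.392] -/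
theorem actionGrad_one : actionGrad F K (1 : GaugeField (F.P K) 0 (Matrix.specialUnitaryGroup (Fin 2) ℂ)) = 0 := by
  apply ContinuousLinearMap.ext
  intro Z
  rw [actionGrad_eq_neg_I_mul_bondPair_J, bgUnits_one, zero_apply]
  have hJ : B9Eq39Adjoint.J (torusT (F.P K) 0) (fun (_ : Fin (F.P K).d) (_ : Site (F.P K) 0) => (1 : (Matrix (Fin 2) (Fin 2) ℂ)ˣ)) 1 = 0 := by
    funext μ x
    simp [B9Eq39Adjoint.J, B9Eq39Adjoint.divPη, B9Eq39Adjoint.divP, B9Eq39Adjoint.plaqU, B9Eq37Insertion.imC, B9Eq39Adjoint.covDstar,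
      B9Eq39Adjoint.R]
  rw [hJ]
  simp [B9Eq39Adjoint.bondPair]

/-- **HENCE `T_Jᴾ(1) = 0`**: the `hPosΔ` slot `Δ^η + T_Jᴾ` at the trivial background IS `Δ^η(1)`. [cite: Balaban1985BackgroundPropagators, (3.127)–(3.128) p.421] -/
theorem TJSlotP_one {h : n ≤ K} {cB a : ℝ} [Fact (0 < c₀)] [Fact (0 < cB)] :
    TJSlotP F n K h c₀ cB a (1 : GaugeField (F.P K) 0 (Matrix.specialUnitaryGroup (Fin 2) ℂ)) = 0 := by
  rw [TJSlotP, TJP_eq_zero_of_actionGrad_eq_zero actionGrad_one, ContinuousLinearMap.toLinearMap_zero]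

/-- … so the slot sum `DeltaEtaSlot + TJSlotP` at `U₀ = 1` is `Δ^η(1)`. [cite: Balaban1985BackgroundPropagators, (3.127)–(3.128) p.421] -/
theorem deltaEtaSlot_add_TJSlotP_one {h : n ≤ K} {cB a : ℝ} [Fact (0 < c₀)] [Fact (0 < cB)] :
    (DeltaEtaSlot F n K c₀ + TJSlotP F n K h c₀ cB a) (1 : GaugeField (F.P K) 0 (Matrix.specialUnitaryGroup (Fin 2) ℂ))
      = (DeltaEta F n K c₀ 1 : BondL2K ℂ 3 (periodsT3 F K) c₀ W₂ →ₗ[ℂ] BondL2K ℂ 3 (periodsT3 F K) c₀ W₂) := by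
  rw [Pi.add_apply, TJSlotP_one, add_zero]
  rfl

/-! ## §4 The divergence `D*(1)` and the site norm at the trivial background -/

/-- At the trivial configuration the [B9]-side background is the unit: `bgOfCfg F K 1 p = 1`. [folklore] -/
theorem bgOfCfg_one (p : Bond 3 (periodsT3 F K)) : bgOfCfg F K (1 : GaugeField (F.P K) 0 (Matrix.specialUnitaryGroup (Fin 2) ℂ)) p = 1 := by
  ext i j
  rw [Prop7SectET3Transport.val_bgOfCfg]
  rfl

/-- ★ **THE MEMBER'S `D*(1)` IS `η⁻¹·∂*₁`**: `toL2S⁻¹(D*_{1}(toL2 X))(x) = η⁻¹ • (diverg 1 X)(x)` — print's (3.8) at `U ≡ 1` is [Balaban1984PropagatorsI] (1.21)'s divergence with the lattice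
factor `η⁻¹` (✓`DstarL2_apply` + the chart's shift-compatibility). [cite: Balaban1985BackgroundPropagators, (3.8) p.392; Balaban1984PropagatorsI, (1.21) p.21] -/
theorem DstarL2_one_apply [Fact (0 < c₀)] (X : PBond (F.P K) 0 → Matrix (Fin 2) (Fin 2) ℂ) (x : Site (F.P K) 0) :
    (toL2S F K c₀).symm (DstarL2 F n K c₀ 1 (toL2 F K c₀ X)) x = (((eta F n K : ℝ) : ℂ)⁻¹) • diverg 1 X x := by
  have hdiv : diverg 1 X x = ∑ μ : Fin (F.P K).d, (X ⟨x.unshift μ, μ⟩ - X ⟨x, μ⟩) := by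
    simp only [LatticeFieldCalculus.diverg, one_smul]
  rw [Prop7SectET3HilbertLetters.DstarL2_apply, hdiv]
  congr 1
  exact Finset.sum_congr rfl fun μ _ => by
    rw [bgOfCfg_one, inv_one, Units.val_one, one_mul, mul_one, bondEquiv_symm_unshift, bondEquiv_symm_siteEquiv]

/-- The weighted site norm entrywise: `‖toL2S λ‖² = c₀ · Σ_x Σ_{jj′} |λ(x)_{jj′}|²`. [cite: Balaban1985BackgroundPropagators, (3.11) p.392] -/
theorem norm_sq_toL2S [Fact (0 < c₀)] (l : Site (F.P K) 0 → Matrix (Fin 2) (Fin 2) ℂ) :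
    ‖toL2S F K c₀ l‖ ^ 2 = c₀ * ∑ x : Site (F.P K) 0, ∑ i, ∑ i', ‖l x i i'‖ ^ 2 := by
  rw [@norm_sq_eq_re_inner ℂ, inner_toL2S, RCLike.re_to_complex, Complex.re_ofReal_mul, Complex.re_sum]
  congr 1
  exact Finset.sum_congr rfl fun x _ => (MatrixNorms.sum_norm_sq_eq_re_trace (l x)).symm

/-! ## §5 The averaging `Q_k(1)` at the trivial background: print's A-units absorb `η` -/

/-- ★ **THE MEMBER'S `Q_k(1)` IN A-UNITS IS THE PLAIN ITERATED BLOCK AVERAGE**: `Q_k(1)(toL2 X) = toL2B (Q_{K−n} X ∘ bondShift)` — `Qk = η • QL2`, `QL2 1 = QTwS 1 = L^{K−n} • bondAvgIter`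
(✓`QTwS_one_apply`), `η·L^{K−n} = 1`: NO power of `η` survives. [cite: Balaban1985Variational, (44)–(45) p.285; Balaban1985BackgroundPropagators, (3.14) p.393] -/
theorem Qk_one_toL2 {h : n ≤ K} {cB : ℝ} [Fact (0 < c₀)] [Fact (0 < cB)] (X : PBond (F.P K) 0 → Matrix (Fin 2) (Fin 2) ℂ) :
    Qk F n K h c₀ cB (1 : GaugeField (F.P K) 0 (Matrix.specialUnitaryGroup (Fin 2) ℂ)) (toL2 F K c₀ X)
      = toL2B F n cB (fun c : PBond (F.P n) 0 => bondAvgIter (K - n) X (T3LevelShift.bondShift (T3PrintedRegularOrbits.sites_eq F n K h) c)) := by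
  rw [Qk, LinearMap.smul_apply, Prop7SectET3HilbertLetters.QL2_toL2, ← map_smul]
  congr 1
  funext c
  have hL : ((F.L : ℕ) : ℂ) ≠ 0 := by exact_mod_cast (lt_trans zero_lt_one F.hL.2).ne'
  have hscal : ((eta F n K : ℝ) : ℂ) * (((F.P K).L : ℕ) : ℂ) ^ (K - n) = 1 := by
    rw [show ((F.P K).L : ℕ) = F.L from rfl, eta]
    push_cast
    rw [inv_pow]
    exact inv_mul_cancel₀ (pow_ne_zero _ hL)
  rw [Pi.smul_apply, Prop7SymAvgTwSym.QTwS_one_apply, smul_smul, hscal, one_smul]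

/-- The weighted block norm entrywise: `‖toL2B B‖² = cB · Σ_c Σ_{jj′} |B(c)_{jj′}|²`. [cite: Balaban1985BackgroundPropagators, (3.16) p.393] -/
theorem norm_sq_toL2B {cB : ℝ} [Fact (0 < cB)] (B : PBond (F.P n) 0 → Matrix (Fin 2) (Fin 2) ℂ) :
    ‖toL2B F n cB B‖ ^ 2 = cB * ∑ c : PBond (F.P n) 0, ∑ i, ∑ i', ‖B c i i'‖ ^ 2 := by
  rw [@norm_sq_eq_re_inner ℂ, inner_toL2B, RCLike.re_to_complex, Complex.re_ofReal_mul, Complex.re_sum]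
  congr 1
  exact Finset.sum_congr rfl fun c _ => (MatrixNorms.sum_norm_sq_eq_re_trace (B c)).symm

/-- ★ **`‖Q_k(1)(toL2 X)‖² = cB · Σ_{c′ : PBond (F.P K) (K−n)} Σ_{jj′} |(Q_{K−n}X)(c′)_{jj′}|²`** — the averaging penalty at the flat member carries the weight `cB` and NO power of `η`
(the coarse bonds of the member `n` re-indexed as the level-`(K−n)` bonds of the fine torus by `bondShift`). [cite: Balaban1985Variational, (44)–(45) p.285; Balaban1984PropagatorsI, (1.18) p.20] -/
theorem norm_sq_Qk_one {h : n ≤ K} {cB : ℝ} [Fact (0 < c₀)] [Fact (0 < cB)] (X : PBond (F.P K) 0 → Matrix (Fin 2) (Fin 2) ℂ) :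
    ‖Qk F n K h c₀ cB (1 : GaugeField (F.P K) 0 (Matrix.specialUnitaryGroup (Fin 2) ℂ)) (toL2 F K c₀ X)‖ ^ 2
      = cB * ∑ c : PBond (F.P K) (K - n), ∑ i, ∑ i', ‖bondAvgIter (K - n) X c i i'‖ ^ 2 := by
  rw [Qk_one_toL2, norm_sq_toL2B]
  congr 1
  exact Fintype.sum_equiv (T3LevelShift.bondShift (T3PrintedRegularOrbits.sites_eq F n K h)) _ _ fun c => rfl

/-- The same split into the `8` REAL components (`Q_k` acts entrywise and commutes with `re`∕`im`). [cite: Balaban1984PropagatorsI, (1.18) p.20; Balaban1985Variational, p.288] -/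
theorem norm_sq_Qk_one_re_im {h : n ≤ K} {cB : ℝ} [Fact (0 < c₀)] [Fact (0 < cB)] (X : PBond (F.P K) 0 → Matrix (Fin 2) (Fin 2) ℂ) :
    ‖Qk F n K h c₀ cB (1 : GaugeField (F.P K) 0 (Matrix.specialUnitaryGroup (Fin 2) ℂ)) (toL2 F K c₀ X)‖ ^ 2
      = cB * ∑ i, ∑ i', (∑ c : PBond (F.P K) (K - n), bondAvgIter (K - n) (fun b => (X b i i').re) c ^ 2
          + ∑ c : PBond (F.P K) (K - n), bondAvgIter (K - n) (fun b => (X b i i').im) c ^ 2) := by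
  rw [norm_sq_Qk_one, sum_entries_re_im]
  congr 1
  refine Finset.sum_congr rfl fun i _ => Finset.sum_congr rfl fun i' _ => ?_
  have hre : ∀ c : PBond (F.P K) (K - n), (bondAvgIter (K - n) X c i i').re = bondAvgIter (K - n) (fun b => (X b i i').re) c := fun c =>
    (ChartHInv.bondAvgIter_comp_apply (Complex.reLm ∘ₗ Matrix.entryLinearMap ℝ ℂ i i') (K - n) X c).symm
  have him : ∀ c : PBond (F.P K) (K - n), (bondAvgIter (K - n) X c i i').im = bondAvgIter (K - n) (fun b => (X b i i').im) c := fun c =>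
    (ChartHInv.bondAvgIter_comp_apply (Complex.imLm ∘ₗ Matrix.entryLinearMap ℝ ℂ i i') (K - n) X c).symm
  simp only [hre, him]

end Summit.QuantumFields.YangMills.Theorems.Prop7LaplaceAFlatLetters

end
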